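import Summits.QuantumAdvantage.QuantumAdvantage.Theses.LinnikCubicClassGroups

/-!
# Crux `LinnikCubicClassGroups.PureCubicClassGroupFBQP` (stmt-QuantumAdvantage-11544) — stub `stub_semDrift`

Line `arakelov-giant-step-cycle`, registered stub `stub_semDrift` (S5b-P5b-D) of skeleton v18: the target coordinate of the class
table is the grid coordinate plus whole periods plus an affine drift plus a `2^-k`-small error (pure real arithmetic).
-/

set_option linter.dupNamespace false

namespace Summit.QuantumAdvantage.QuantumAdvantage.Theorems.LinnikCubicClassGroups

/-- **S5b-P5b-D `stub_semDrift`**: with `R̂ = r/2^k`, `|r − 2^k R| ≤ 1`, the target `t⋆ = j'·r·2^(prec−k−s) + N·r·2^(prec−k)` and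
`|N − main/R̂| ≤ BN` (note `2^prec·main/(r 2^(prec−k)) = main/R̂`): `t⋆/2^prec` is `j' R/2^s + N R + ((R̂ − R)/R̂)·main` up to
`(BN + 1)/2^k`. [Hallgren 2005 §4] -/
theorem stub_semDrift :
    ∀ (prec k s r : ℕ) (R main BN : ℝ) (j' : ℕ) (N tstar : ℤ), 0 < r → k + s ≤ prec → j' < 2 ^ s →
      |(r : ℝ) - 2 ^ k * R| ≤ 1 →
      tstar = ((j' * r * 2 ^ (prec - k - s) : ℕ) : ℤ) + N * ((r * 2 ^ (prec - k) : ℕ) : ℤ) →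
      |(N : ℝ) - 2 ^ prec * main / ((r * 2 ^ (prec - k) : ℕ) : ℝ)| ≤ BN →
      |(tstar : ℝ) / 2 ^ prec -
          ((j' : ℝ) * (R / ((2 ^ s : ℕ) : ℝ)) + (N : ℝ) * R + ((r : ℝ) / 2 ^ k - R) / ((r : ℝ) / 2 ^ k) * main)| ≤
        (BN + 1) / 2 ^ k := by
  intro prec k s r R main BN j' N tstar hr hks hj hR htstar hN
  -- split the precision as `prec = m + k + s`
  obtain ⟨m, rfl⟩ : ∃ m, prec = m + k + s := ⟨prec - k - s, by omega⟩
  have h1 : m + k + s - k - s = m := by omega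
  have h2 : m + k + s - k = m + s := by omega
  rw [h1, h2] at htstar
  rw [h2] at hN
  have hr' : (0 : ℝ) < r := Nat.cast_pos.mpr hr
  have hr0 : (r : ℝ) ≠ 0 := hr'.ne'
  have h2k : (0 : ℝ) < 2 ^ k := by positivity
  have h2s : (0 : ℝ) < 2 ^ s := by positivity
  -- the target, cast to `ℝ`
  have htR : (tstar : ℝ) = (j' : ℝ) * r * 2 ^ m + (N : ℝ) * (r * 2 ^ (m + s)) := by
    have := congrArg (Int.cast : ℤ → ℝ) htstar
    push_cast at this
    linarith
  -- exact algebraic identity: the difference is `δ · (j'/2^s + (N − main/R̂))` with `δ = R̂ − R`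
  have key : (tstar : ℝ) / 2 ^ (m + k + s) -
      ((j' : ℝ) * (R / ((2 ^ s : ℕ) : ℝ)) + (N : ℝ) * R + ((r : ℝ) / 2 ^ k - R) / ((r : ℝ) / 2 ^ k) * main) =
      (((r : ℝ) - 2 ^ k * R) / 2 ^ k) *
        ((j' : ℝ) / 2 ^ s + ((N : ℝ) - 2 ^ (m + k + s) * main / ((r * 2 ^ (m + s) : ℕ) : ℝ))) := by
    rw [htR]
    push_cast
    field_simp
    ring
  rw [key, abs_mul, abs_div, abs_of_pos h2k]
  -- bound the two factors
  have hj' : (j' : ℝ) / 2 ^ s ≤ 1 := by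
    rw [div_le_one h2s]
    exact_mod_cast hj.le
  have hj0 : (0 : ℝ) ≤ (j' : ℝ) / 2 ^ s := by positivity
  have hB : |(j' : ℝ) / 2 ^ s + ((N : ℝ) - 2 ^ (m + k + s) * main / ((r * 2 ^ (m + s) : ℕ) : ℝ))| ≤
      BN + 1 := by
    refine (abs_add_le _ _).trans ?_
    rw [abs_of_nonneg hj0]
    linarith
  have hBN0 : 0 ≤ BN + 1 := (abs_nonneg _).trans hB
  calc |(r : ℝ) - 2 ^ k * R| / 2 ^ k *
        |(j' : ℝ) / 2 ^ s + ((N : ℝ) - 2 ^ (m + k + s) * main / ((r * 2 ^ (m + s) : ℕ) : ℝ))|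
      ≤ 1 / 2 ^ k * (BN + 1) :=
        mul_le_mul (div_le_div_of_nonneg_right hR h2k.le) hB (abs_nonneg _) (by positivity)
    _ = (BN + 1) / 2 ^ k := by ring

end Summit.QuantumAdvantage.QuantumAdvantage.Theorems.LinnikCubicClassGroups
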